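import HarnessLib.Audit
import Summits.ValiantsHypothesis.ValiantsHypothesis.Theorems.ValuativeGCTValuativeFlipCyclicTridiagonalContinuant

/-!
# Route «KPlusLogSqLaw», crux `WeakLifting` (stmt-ValiantsHypothesis-19561) — REAL side of the tridiagonal sector:
# the POTENTIAL of a root word and CONJECTURE (P) (definitions)

HONEST FRAMING.  Definitions file (D-0009: reviewed) for the helper line (`--supports stmt-ValiantsHypothesis-19561 --as helper`) on
the REAL side of the witness-plan stub `stub_tridiagonalSectorB` (`Cruxes/WeakLifting/Lines/birth.lean`): the static definite symmetric
tridiagonal sub-sector, «α register», UPPER side.  Seat val-sym-lift-p3 (g10), cell `pub-symmetroid`, 2026-08-27, desk rulings R2278 (B)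
(«type (P) as a named Prop `PotentialLawP` over the tree's continuant currency») and R2314.  It names, and asserts NOTHING about:
* `theta w` — the POTENTIAL of a two-letter word `w : List Bool` (seat memo HIERARCHICAL-LIMIT-GAME-liftp3g9.md §3b): the maximum over
  labelings `lab` of the positions by letters of `#{i : w i = lab i} − #{i : lab i ≠ lab (i+1)}`; equivalently `max_j (B_j(w) − (j − 1))`
  where `B_j(w)` is the largest number of letters collected by `≤ j` consecutive blocks with alternating designated letters (a labeling with
  `c` changes IS a partition into `c + 1` alternating blocks).  The subtraction is truncated in `ℕ`; this changes nothing because a constant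
  labeling has no changes, so the maximum is attained at a nonnegative value (documented junk-freeness);
* `rootWord P Q` — the ROOT WORD of an ordered pair of real polynomials: the positive roots of `P · Q` in increasing order, each root `x`
  contributing `rootMultiplicity x P` letters `false` («p», the older continuant) followed by `rootMultiplicity x Q` letters `true` («q»);
  MULTIPLICITIES ARE COUNTED (memo §7b: without them the tangent «boost» design itself would violate (P)).  When `P · Q = 0` the word is `[]`
  (Mathlib's `roots 0 = 0`); when `P` and `Q` share a positive root the `p`-letters precede the `q`-letters — neither case occurs under the
  hypotheses of (P) below (nonzero links ⇒ consecutive continuants share no positive zero; the row file proves it);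
* `pathDet a d b f k` — the CONTINUANT CURRENCY: the determinant of the `k × k` path matrix (`ValuativeFlip.ctPath`) with diagonal entries
  `C (a t) · X ^ (d t)` and symmetric links `C (b t) · X ^ (f t)` in cells `(t, t+1)`, `(t+1, t)` — the general STATIC SYMMETRIC TRIDIAGONAL
  monomial design (definite iff `0 < a t`); by the tree's `det_ctPath` (…TridiagonalRealStatic, lift-p3 g8) it satisfies
  `D₀ = 1`, `D₁ = a₀ X^{d₀}`, `D_{t+2} = a_{t+1} X^{d_{t+1}} D_{t+1} − b_t² X^{2 f_t} D_t`;
* `PotentialStep k` / `PotentialLawP` — one step of, resp. the whole, CONJECTURE (P) (LOCATED, NOT PROVED; memo §7b: survived ≈ 4·10³ adversarial generic finite-speed instances, `m ≤ 8`,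
  and holds with equality along the extremal hierarchical designs): for every static DEFINITE symmetric tridiagonal design with NONZERO links
  and every `k`, `theta (rootWord D_{k+1} D_{k+2}) ≤ theta (rootWord D_k D_{k+1}) + 2` — one new edge raises the potential of the root word
  of the last two continuants by at most two.  It is a `@[conjecture] def … : Prop` (obligation node: provable / refutable by name), never asserted; the row file proves
  `PotentialLawP → card posRoots ≤ 2m − 2` for the WHOLE static definite tridiagonal sector (desk words «CONDITIONAL UPPER ROW»), so the
  α register's upper side REDUCES to (P).  (P) is a statement of this cell, not a published result — hence a route-side `…Defs` file, not a
  Literature fact.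
Nothing here bears on `WeakLifting` / `TropicalB` (stmt-19771) in their windows, on Conjecture B, on the Door-A registers, on
`MatrixDescartes` (stmt-ValiantsHypothesis-18050) or on VP ≠ VNP.

[this cell's located conjecture (P), memo HIERARCHICAL-LIMIT-GAME-liftp3g9.md §3b/§7b; folklore (continuants, root words)]
-/

-- `Summit.ValiantsHypothesis.ValiantsHypothesis.…` repeats a component by the D-0017 layout (single-conjunct summit); the name is mandated.
set_option linter.dupNamespace false
set_option autoImplicit false

namespace Summit.ValiantsHypothesis.ValiantsHypothesis.Theorems.KPlusLogSqLaw

namespace StaticTridiagonalRealPotential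

open Polynomial Finset
open Summit.ValiantsHypothesis.ValiantsHypothesis.Theorems.ValuativeFlip (ctPath)

noncomputable section

/-- The **potential** `Θ(w)` of a two-letter word (letters `false` = «p», `true` = «q»): the maximum over labelings `lab` of the
positions of `#{i : w i = lab i} − #{i : lab i ≠ lab (i+1)}` (agreements minus label changes; `ℕ`-truncated, attained untruncated at a
constant labeling), i.e. `max_j (B_j(w) − (j − 1))` over partitions into `≤ j` alternating blocks.  `theta [] = 0`.
[this cell's memo HIERARCHICAL-LIMIT-GAME-liftp3g9.md §3b] -/
def theta (w : List Bool) : ℕ :=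
  (Finset.univ : Finset (Fin w.length → Bool)).sup fun lab =>
    (Finset.univ.filter fun i : Fin w.length => w.get i = lab i).card -
      (Finset.univ.filter fun i : Fin w.length => ∃ h : (i : ℕ) + 1 < w.length, lab i ≠ lab ⟨(i : ℕ) + 1, h⟩).card

/-- The **root word** of the ordered pair `(P, Q)`: the positive roots of `P · Q` in increasing order, each root `x` spelled as
`rootMultiplicity x P` letters `false` followed by `rootMultiplicity x Q` letters `true` (multiplicities counted; `[]` when `P · Q = 0`).
[folklore; this cell's memo §7b] -/
def rootWord (P Q : ℝ[X]) : List Bool :=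
  (((P * Q).roots.toFinset.filter fun x => 0 < x).sort (· ≤ ·)).flatMap fun x =>
    List.replicate (P.rootMultiplicity x) false ++ List.replicate (Q.rootMultiplicity x) true

/-- The **continuant currency**: the determinant `D_k` of the `k × k` static symmetric tridiagonal monomial design with diagonal entries
`C (a t) · X ^ (d t)` and links `C (b t) · X ^ (f t)` in cells `(t, t+1)` and `(t+1, t)` (the path matrix `ValuativeFlip.ctPath`);
`D₀ = 1`, `D₁ = a₀ X^{d₀}`, `D_{t+2} = a_{t+1} X^{d_{t+1}} · D_{t+1} − b_t² X^{2 f_t} · D_t` by `det_ctPath`. [folklore: continuants] -/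
def pathDet (a : ℕ → ℝ) (d : ℕ → ℕ) (b : ℕ → ℝ) (f : ℕ → ℕ) (k : ℕ) : ℝ[X] :=
  (ctPath (fun t => C (a t) * X ^ d t) (fun t => C (b t) * X ^ f t) (fun t => C (b (t - 1)) * X ^ f (t - 1)) k).det

/-- **One step of the potential law**, `(P)_k`: for every static DEFINITE (`0 < a t`) symmetric tridiagonal monomial design with
NONZERO links (`b t ≠ 0`), appending the edge `k → k+1` raises the potential of the root word of the last two continuants by at most two:
`Θ(rootWord D_{k+1} D_{k+2}) ≤ Θ(rootWord D_k D_{k+1}) + 2`.  A predicate in `k` (the rungs «(P) at `m = k + 2`» of R2278 are its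
instances; `(P)_0`, `(P)_1` are elementary, `(P)_2` = «(P) at `m = 4`»).  OPEN in general; nothing asserted.
[this cell's located conjecture, memo HIERARCHICAL-LIMIT-GAME-liftp3g9.md §7b] -/
def PotentialStep (k : ℕ) : Prop :=
  ∀ (a : ℕ → ℝ) (d : ℕ → ℕ) (b : ℕ → ℝ) (f : ℕ → ℕ), (∀ t, 0 < a t) → (∀ t, b t ≠ 0) →
    theta (rootWord (pathDet a d b f (k + 1)) (pathDet a d b f (k + 2))) ≤
      theta (rootWord (pathDet a d b f k) (pathDet a d b f (k + 1))) + 2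

/-- **CONJECTURE (P) — the potential law** (LOCATED, NOT PROVED; an `@[conjecture]` obligation node, never asserted): every step
`(P)_k` holds — for every static definite symmetric tridiagonal monomial design with nonzero links and every `k`, one new edge raises the
potential of the root word of the last two continuants by at most two.  Memo §7b: survived ≈ 4·10³ adversarial generic finite-speed
instances (`m ≤ 8`) and holds with equality along the extremal hierarchical designs; the splice inequality (S) is false at finite speed,
so (P) is the live local statement.  It implies `card posRoots(D_m) ≤ 2m − 2` on the WHOLE static definite tridiagonal sector (row file
`…PotentialRow`, zero links included by block splitting); located ceiling candidate `2m` = the `α = 2` case of the Cameron–Psarrakos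
matrix Descartes conjecture; located floor `2m − 6` (pump-and-harvest). [this cell's located conjecture, memo HIERARCHICAL-LIMIT-GAME-liftp3g9.md §7b] -/
@[conjecture] def PotentialLawP : Prop := ∀ k : ℕ, PotentialStep k

end

end StaticTridiagonalRealPotential

end Summit.ValiantsHypothesis.ValiantsHypothesis.Theorems.KPlusLogSqLaw
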